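import Summits.PneNP.PneNP.Theses.SzkEntropy
import Summits.PneNP.PneNP.Theorems.SzkEntropyPeaThreeNotInP
import Literature.Computability.Complexity.PolynomialEntropyApproximation
import Literature.Computability.Complexity.PromiseZPPProofs
import Summits.PneNP.PneNP.Theorems.SzkEntropyCookModelBridge
import Summits.PneNP.PneNP.Theorems.SzkEntropyPhCollapse

/-!
# Disproof of `PeaTwoMemBPP` (crux stmt-PneNP-10778, route PneNP/SzkEntropy) — standing adversary file

Crux (rank 4, "first rung of the algorithmic ladder", filed OPEN BOTH WAYS):

  `PeaTwoMemBPP : PEA 2 ∈ PromiseBPP'` — entropy approximation with additive gap 1 for QUADRATIC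
  maps `q : F₂ⁿ → F₂ᵐ` (sparse monomial lists; `H(q(U_n)) ≥ k+1` vs `≤ k`) is in textbook promise-BPP.

Author: refuter-cdisprove-stmt-PneNP-10778-0 (cycle 1, 2026-08-15); §7-additions, §9, §10 by
refuter-cdisprove-stmt-PneNP-10778-g2-0 (cycle 2, 2026-08-16).  Everything below is a CHECKED
theorem (`lean check` rc 0, no `sorry`) unless marked REMARK; `native_decide` is used in §4–§6 for
finite evaluations (axiom `Lean.ofReduceBool`, flagged `computational`).  Python companions:
`py/census.py`, `py/search2.py`, `py/verify12.py`, `py/gadget.py` (attached as evidence).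

## Findings — index

§1 IDENTIFICATION. The crux, the kill switch and the thesis are `Iff.rfl`-equal to statements about
   the library problem `Literature.Computability.Complexity.PEA` (`peaTwoMemBPP_iff`, …), so the
   library API (`PEA_yes_mono`, `PolyMapF2.entropy_prod`, …) applies verbatim.
§2 DEGREE MONOTONICITY for promise-BPP: `PEA_mem_PromiseBPP'_of_le`; hence
   `peaThreeMemBPP_imp_peaTwoMemBPP : PeaThreeMemBPP → PeaTwoMemBPP` (kill switch ⇒ crux).
§3 WHY IT RESISTS (load-bearing analysis; LANDED as Theorems/PeaTwoMemBPP/Negative/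
   NotPeaTwoMemBPPImpliesTarget.lean, p69928 + rev 3 p71061 commit 95725ac2ae0f, names
   `szkEntropy_not_peaTwoMemBPP_*`). The crux has NO
   hypotheses to drop; instead:
   `not_peaTwoMemBPP_imp_peaThreeNotInP : ¬PeaTwoMemBPP → PeaThreeNotInP` (via the PROVED tree fact
   `PromiseP ⊆ PromiseBPP'`) and `not_peaTwoMemBPP_closes : ¬PeaTwoMemBPP → PeaMemPH → PhCollapse →
   CookModelBridge → PneNP` (the route's certified `closes`).  A disproof of this crux is therefore an
   unconditional randomized lower bound that already proves thesis X and — with three provable-now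
   supports — the summit.  No `_false_without_` theorem can exist short of P ≠ NP; mis-statement was
   excluded by 20+ refuter audits (encoding, entropy formula, promise) and re-confirmed by §1.
§4 CENSUS NON-DETERMINISM (LANDED as Theorems/PeaTwoMemBPP/Negative/CensusDoesNotDetermineEntropy.lean,
   p69640, commit 1dc06540ec5f; the planner's cheapest falsifier (2), executed and settled NEGATIVELY for the
   census heuristic): the signed Dickson/Arf bias census of the pencil `{c·q : c ∈ F₂ᵐ}` — which fixes
   the whole Walsh spectrum up to relabelling, hence the collision/Rényi entropy — does NOT determine
   the Shannon entropy: `census_witC_eq_witD ∧ one_lt_entropy_gap_CD` exhibit two quadratic maps on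
   n = 12, m = 10 with IDENTICAL census and Shannon entropies 6.4056… vs 7.7678… (gap > 1).  So no
   algorithm that reads only the rank/type census of the pencil (however exactly computed) solves
   PEA₂, and "the census predicts H to within 1/2" is false.  Gaps add under direct products
   (`entropy_prod`) and the census is MULTIPLICATIVE (`census_prod`, §4.7, proved in general; LANDED as
   Theorems/PeaTwoMemBPP/Negative/CensusMultiplicative.lean, p71051, commit 6a37d2f02f78), so
   census-equivalent pairs have UNBOUNDED entropy gaps (`census_equivalent_gap_unbounded`).  Base pairs: n = 4 (gap 0.3688, `entropy_gap_AB`), n = 8 (gap 0.9934, `entropy_gap_P14`).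
§5 SHANNON vs RÉNYI at q = 2 (LANDED with §6 as Theorems/PeaTwoMemBPP/Negative/RenyiAndSignedDegreeReduction.lean,
   p71033, commit 3be1a6a18ef9; tightness of DGRV Thm 5.3's regime): `renyiFamily 7` = (x₀, x₀x₁, …,
   x₀x₆) has Shannon entropy EXACTLY 4 (`entropy_renyiFamily7`) while its collision count is 4160,
   i.e. H₂ = 14 − log₂ 4160 < 2 (`collisionCount_renyiFamily7`); in the family H = (m+1)/2 → ∞ with
   H₂ < 2, so no Rényi-based (derivative-rank / bias-moment) estimate reaches additive gap 1.
§6 SIGNED ONE-STEP DEGREE REDUCTION (new; informs both camps). For a cubic monomial x_a x_b x_c in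
   coordinate i of a cubic map p, eight explicit maps with that monomial REMOVED — q_u (u one of the 7
   nonzero linear forms in x_a,x_b,x_c; one fresh variable, one extra output) and q_W (three fresh
   variables, three extra outputs) — satisfy the exact identity
       H(p) = (1/3) Σ_u H(q_u) − (4/3) H(q_W) + 5/3,   equivalently   Π(p)⁶ · Π(q_W) = ∏_u Π(q_u)
   on fibre products (REMARK 6.1; identity (1) `H(q_u) = 1 + ½H(p) + ½H(p+u eᵢ)` is PROVED IN GENERAL,
   `entropy_gadget`, §6.0; `gadget_identity_x012` checks the integer form of (3) for
   p = x₀x₁x₂ by `native_decide`; `py/gadget.py` checks 22 random cubic maps).  Consequences (REMARK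
   6.2): PeaTwoMemBPP ⇒ PEA₃ restricted to maps with ≤ c·log n cubic monomial occurrences is in prBPP
   for every c (8^T instances, precision (3/11)^T via direct products) — hardness at degree 3 (thesis X)
   must use ω(log n) genuinely cubic terms, and a PEA₂ algorithm automatically handles almost-quadratic
   cubic maps; the sign pattern (ℓ₁-mass 11/3 per monomial, optimal for uniform-subspace averaging)
   is what blocks a full Karp/Cook reduction PEA₃ ≤ PEA₂ along this line.
§8 (REMARK) the linearised-fibre rank estimator E1 = E_x rank L_x: exact on some families, fails
   additively (x₀x₁ blocks: −0.0613 each; all-products maps: → −1); any product-additive inexact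
   estimator fails PEA₂ by amplification.
§9 (cycle 2) DIRECTIONAL PROFILES. The collision profile `W(h) = #{x : q(x+h) = q(x)}` and the kernel /
   derivative-RANK profile `K(h) = 2^{n−ρ(h)}` over ALL `2ⁿ` directions, TOGETHER WITH the census, do not
   determine the entropy: `witE/witF` (n = m = 4) agree in all three and differ by `> 2/5` bit
   (`profiles_do_not_determine_entropy`); all three invariants are multiplicative under direct products, so
   the gaps are unbounded (LANDING as Theorems/PeaTwoMemBPP/Negative/DirectionalProfilesDoNotDetermineEntropy.lean,
   p72024).  Every "one-point" statistic of DGRV (Claim 5.6 census, Lemma 5.1/5.2 derivative ranks) is thereby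
   exhausted; entropy needs positional two-point data.
§10 (cycle 2) NO EXACT LOCAL GADGET. An entropy-exact quadratic replacement of one cubic monomial (which would
   give a Karp reduction PEA₃ ≤ PEA₂ and make the crux equivalent to the kill switch) is reduced, by seven test
   maps and the ℚ-independence of log 3, log 5, log 7, to: a ξ-INDEPENDENT quadratic map `B(ξ,w)` and a Boolean
   `c` with `deg(x_ax_bx_c + c∘B) ≤ 2` (THEOREM 10.1); exhaustive search kills all gadgets with `t' = 2, s ≤ 4`,
   `t' = 3, s ≤ 3`, `s = 1` (THEOREM 10.2), a paper proof kills the one-time-pad family (THEOREM 10.3), and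
   THEOREM 10.4 (machine-checked, Negative/NoXiIndependentQuadraticEncoding.lean + QuadraticCharSums.lean)
   kills ALL sizes: no ξ-independent quadratic `B` and Boolean `c` have `deg(x_ax_bx_c + c∘B) ≤ 2` ("3 ∤ 2ʲ":
   the bias 3/4 of the monomial survives conditioning on B, quadratic character sums are 0 or ±2ʲ).  So NO
   entropy-exact local quadratic gadget exists; the signs of §6 (3) are necessary; PEA₃ ≤ PEA₂, if at all, is non-local.
§7 REGIMES TRIED / WHY NO COUNTEREXAMPLE (REMARK): hardness embeddings at degree 2 that were tried and
   why each fails to bite (LPN/syndrome entropy, GapNCP via 1-bit coset channel, IK randomizing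
   polynomials without R₂, MQ planted counting) — briefing for the next cycle and for provers.
-/

namespace Summit.PneNP.PneNP.Cruxes.PeaTwoMemBPP.Disproof

open Literature.Computability.Complexity Literature.InformationTheory.Entropy
open Summit.PneNP.PneNP.Theses.SzkEntropy
open PolyMapF2

/-! ## §1 Identification with the library problem `PEA` -/

/-- The crux is literally `PEA 2 ∈ PromiseBPP'` for the library's `PEA`
(`PolynomialEntropyApproximation.lean`; same encoding, same sets, `entropy = mapEntropy univ eval`). -/
theorem peaTwoMemBPP_iff : PeaTwoMemBPP ↔ PEA 2 ∈ PromiseBPP' := Iff.rfl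

/-- The kill switch is literally `PEA 3 ∈ PromiseBPP'`. -/
theorem peaThreeMemBPP_iff : PeaThreeMemBPP ↔ PEA 3 ∈ PromiseBPP' := Iff.rfl

/-! ## §2 Degree monotonicity for textbook promise-BPP -/

/-- Textbook promise-BPP is antitone in the promise: shrinking the yes- and no-sets keeps membership
(same witness language, same coin polynomial). [Goldreich 2006, §1.2] -/
theorem mem_PromiseBPP'_anti {Q Q' : PromiseProblem} (hy : Q.yes ≤ Q'.yes) (hn : Q.no ≤ Q'.no)
    (h : Q' ∈ PromiseBPP') : Q ∈ PromiseBPP' := by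
  obtain ⟨L', hL', p, hyes, hno⟩ := h
  exact ⟨L', hL', p, fun x hx => hyes x (hy hx), fun x hx => hno x (hn hx)⟩

/-- `PEA d' ∈ PromiseBPP' → PEA d ∈ PromiseBPP'` for `d ≤ d'` (the instance sets grow with `d`). -/
theorem PEA_mem_PromiseBPP'_of_le {d d' : ℕ} (h : d ≤ d') (h' : PEA d' ∈ PromiseBPP') :
    PEA d ∈ PromiseBPP' :=
  mem_PromiseBPP'_anti (PEA_yes_mono h) (PEA_no_mono h) h'

/-- **The kill switch implies the crux**: `PeaThreeMemBPP → PeaTwoMemBPP`. -/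
theorem peaThreeMemBPP_imp_peaTwoMemBPP (h : PeaThreeMemBPP) : PeaTwoMemBPP :=
  peaTwoMemBPP_iff.2 (PEA_mem_PromiseBPP'_of_le (by norm_num) (peaThreeMemBPP_iff.1 h))

/-! ## §3 Why it resists: the negation of the crux is the thesis, and the summit -/

/-- `¬ PeaTwoMemBPP → PEA 2 ∉ PromiseP`, by the PROVED tree theorem `PromiseP ⊆ PromiseBPP'`. -/
theorem not_peaTwoMemBPP_imp_PEA_two_notInP (h : ¬ PeaTwoMemBPP) : PEA 2 ∉ PromiseP :=
  fun h2 => h (peaTwoMemBPP_iff.2 (PromiseP_subset_PromiseBPP' h2))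

/-- **A disproof of the crux proves the route's thesis X** (`PEA 3 ∉ PromiseP`). -/
theorem not_peaTwoMemBPP_imp_peaThreeNotInP (h : ¬ PeaTwoMemBPP) : PeaThreeNotInP :=
  Summit.PneNP.PneNP.Theorems.szkEntropy_peaThreeNotInP_of_le (d := 2) (by norm_num)
    (not_peaTwoMemBPP_imp_PEA_two_notInP h)

/-- … and refutes the kill switch. -/
theorem not_peaTwoMemBPP_imp_not_peaThreeMemBPP (h : ¬ PeaTwoMemBPP) : ¬ PeaThreeMemBPP :=
  fun h3 => h (peaThreeMemBPP_imp_peaTwoMemBPP h3)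

/-- **A disproof of the crux proves the summit, given the three provable-now supports**, through the
route's certified deciding theorem `closes`.  (This is the load-bearing analysis of a hypothesis-free
crux: its negation is a uniform randomized lower bound for an `SZK_L` problem; no weakening on the
algorithmic side changes that.) -/
theorem not_peaTwoMemBPP_closes (h : ¬ PeaTwoMemBPP) (hPH : PeaMemPH) (hC : PhCollapse)
    (hB : CookModelBridge) : _root_.PneNP :=
  closes (not_peaTwoMemBPP_imp_peaThreeNotInP h) hPH hC hB

/-- **Sharper: a disproof of the crux plus the ONE printed support `PeaMemPH` proves the summit** —
`PhCollapse` and `CookModelBridge` are now PROVED tree theorems (`szkEntropy_phCollapse_proof`,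
`cookModelBridge_proof`). -/
theorem not_peaTwoMemBPP_imp_pneNP_of_peaMemPH (h : ¬ PeaTwoMemBPP) (hPH : PeaMemPH) : _root_.PneNP :=
  not_peaTwoMemBPP_closes h hPH Summit.PneNP.PneNP.Theorems.szkEntropy_phCollapse_proof
    Summit.PneNP.PneNP.Theorems.cookModelBridge_proof

/-! ## §4 The bias census of the pencil does not determine the Shannon entropy -/

variable {n : ℕ}

/-- The output distribution of `P` as a multiset: `{P(x) : x ∈ F₂ⁿ}` with multiplicity. -/
def outputs (P : PolyMapF2 n) : Multiset (List (ZMod 2)) :=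
  (Finset.univ : Finset (Fin n → ZMod 2)).val.map P.eval

/-- Dot product of a character, given as a coefficient list, with an output list (`zipWith`, so
missing entries are dropped — all output lists of `P` have length `P.length`). -/
def dotL (cl l : List (ZMod 2)) : ZMod 2 :=
  (List.zipWith (· * ·) cl l).sum

/-- Integer bias `#{x : c·P(x) = 0} − #{x : c·P(x) = 1} = 2ⁿ · bias(c·P)` of the member `c·P` of
the pencil, computed from the output multiset `O = outputs P` and the coefficient list of `c`. -/
def intBias (O : Multiset (List (ZMod 2))) (cl : List (ZMod 2)) : ℤ :=
  (O.map fun l => if dotL cl l = 0 then (1 : ℤ) else -1).sum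

/-- The **signed bias census** of the pencil `{c·P : c ∈ F₂ᵐ}`: the multiset of the integer biases of
all `2ᵐ` members.  For quadratic `P` each member is a quadratic function, whose bias is `0` or
`±2^{-h}` with `2h` the rank of its alternating part and the sign its Arf type (Dickson), so this IS the
rank/type census of the planner's falsifier (2), with signs (finer).  It determines the Walsh spectrum
as a multiset, hence every Rényi-2 quantity (Parseval: `2^{-H₂} = 2^{-m} Σ_c bias(c·P)²`). -/
def census (P : PolyMapF2 n) : Multiset ℤ :=
  let O := outputs P
  (Finset.univ : Finset (Fin P.length → ZMod 2)).val.map fun c => intBias O (List.ofFn c)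

/-- Product of the fibre sizes over all inputs, `Π(P) := ∏_x #{x' : P x' = P x}` — the datum of the
Shannon entropy: `H(P(U_n)) = n − log₂ Π(P) / 2ⁿ` (`entropy_eq_sub_logb_fiberProd`). -/
def fiberProd (P : PolyMapF2 n) : ℕ :=
  ∏ x : Fin n → ZMod 2, (fiber Finset.univ P.eval (P.eval x)).card

/-- **Entropy bridge** (general): `H(f(U_S)) = log₂|S| − log₂(∏_{v∈S} |f⁻¹(f v) ∩ S|) / |S|`. -/
theorem mapEntropy_eq_logb_sub {ι β : Type*} [DecidableEq β] {S : Finset ι} (hS : S.Nonempty)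
    (f : ι → β) :
    mapEntropy S f = Real.logb 2 S.card -
      Real.logb 2 (∏ v ∈ S, ((fiber S f (f v)).card : ℝ)) / S.card := by
  have hScard : (S.card : ℝ) ≠ 0 := by exact_mod_cast (Finset.card_pos.2 hS).ne'
  have hF : ∀ v ∈ S, ((fiber S f (f v)).card : ℝ) ≠ 0 := fun v hv => by
    exact_mod_cast (card_fiber_pos f hv).ne'
  unfold mapEntropy
  rw [Real.logb_prod _ _ hF]
  have : ∀ v ∈ S, Real.logb 2 ((S.card : ℝ) / (fiber S f (f v)).card) =
      Real.logb 2 S.card - Real.logb 2 (fiber S f (f v)).card := fun v hv =>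
    Real.logb_div hScard (hF v hv)
  rw [Finset.sum_congr rfl this, Finset.sum_sub_distrib, Finset.sum_const, nsmul_eq_mul]
  field_simp

/-- **Entropy bridge for sparse maps**: `H(P(U_n)) = n − log₂ Π(P) / 2ⁿ`. -/
theorem entropy_eq_sub_logb_fiberProd (P : PolyMapF2 n) :
    P.entropy = n - Real.logb 2 (fiberProd P) / 2 ^ n := by
  have hcard : ((Finset.univ : Finset (Fin n → ZMod 2)).card : ℝ) = 2 ^ n := by
    rw [Finset.card_univ, Fintype.card_fun, ZMod.card, Fintype.card_fin]
    push_cast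
    rfl
  unfold PolyMapF2.entropy
  rw [mapEntropy_eq_logb_sub Finset.univ_nonempty, hcard, fiberProd]
  push_cast
  congr 1
  rw [Real.logb_pow, Real.logb_self_eq_one one_lt_two, mul_one]

/-- Entropy differences are differences of `log₂ Π`, scaled by `2ⁿ`. -/
theorem entropy_sub_entropy (P Q : PolyMapF2 n) :
    Q.entropy - P.entropy = (Real.logb 2 (fiberProd P) - Real.logb 2 (fiberProd Q)) / 2 ^ n := by
  rw [entropy_eq_sub_logb_fiberProd, entropy_eq_sub_logb_fiberProd]
  ring

/-- Fibre products are positive (every point lies in its own fibre). [folklore] -/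
theorem fiberProd_pos (P : PolyMapF2 n) : 0 < fiberProd P :=
  Finset.prod_pos fun x _ => card_fiber_pos _ (Finset.mem_univ x)

/-- From the integer inequality `2ᵏ · Π(Q)ʲ < Π(P)ʲ` to the entropy gap `H(Q) − H(P) > k/(j·2ⁿ)`. -/
theorem entropy_gap_of_fiberProd_pow {P Q : PolyMapF2 n} {j k : ℕ} (hj : 0 < j)
    (h : 2 ^ k * fiberProd Q ^ j < fiberProd P ^ j) :
    (k : ℝ) / (j * 2 ^ n) < Q.entropy - P.entropy := by
  rw [entropy_sub_entropy]
  have hQ : (0 : ℝ) < fiberProd Q := by exact_mod_cast fiberProd_pos Q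
  have hP : (0 : ℝ) < fiberProd P := by exact_mod_cast fiberProd_pos P
  have hlt : Real.logb 2 ((2 : ℝ) ^ k * (fiberProd Q : ℝ) ^ j) < Real.logb 2 ((fiberProd P : ℝ) ^ j) :=
    Real.logb_lt_logb one_lt_two (by positivity) (by exact_mod_cast h)
  rw [Real.logb_mul (by positivity) (by positivity), Real.logb_pow, Real.logb_pow, Real.logb_pow,
    Real.logb_self_eq_one one_lt_two, mul_one] at hlt
  have hj' : (0 : ℝ) < j := by exact_mod_cast hj
  rw [div_lt_div_iff₀ (by positivity) (by positivity)]
  nlinarith [hlt, pow_pos (show (0:ℝ) < 2 by norm_num) n]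

/-- The case `j = 1`: `2ᵏ · Π(Q) < Π(P)` gives `H(Q) − H(P) > k/2ⁿ`. -/
theorem entropy_gap_of_fiberProd {P Q : PolyMapF2 n} {k : ℕ} (h : 2 ^ k * fiberProd Q < fiberProd P) :
    (k : ℝ) / 2 ^ n < Q.entropy - P.entropy := by
  have h' : 2 ^ k * fiberProd Q ^ 1 < fiberProd P ^ 1 := by rw [pow_one, pow_one]; exact h
  have := entropy_gap_of_fiberProd_pow one_pos h'
  rw [Nat.cast_one, one_mul] at this
  exact this

/-- Exact entropy from an exact fibre product that is a power of two: `Π(P) = 2ᵉ ⇒ H = n − e/2ⁿ`. -/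
theorem entropy_of_fiberProd_eq_two_pow {P : PolyMapF2 n} {e : ℕ} (h : fiberProd P = 2 ^ e) :
    P.entropy = n - (e : ℝ) / 2 ^ n := by
  rw [entropy_eq_sub_logb_fiberProd, h]
  push_cast
  rw [Real.logb_pow, Real.logb_self_eq_one one_lt_two, mul_one]

/-! ### 4.1 Base witness pair on `n = 4`, `m = 4` (random search `py/census.py`, seed 3) -/

/-- `A = (x₀x₁ + x₂ + x₀x₂ + x₁x₂ + x₁x₃, 1 + x₂ + x₃, x₁x₂ + x₀x₃ + x₁x₃ + x₂x₃,
x₀ + x₀x₁ + x₁x₂ + x₃ + x₀x₃ + x₁x₃)`, `H = 4 − log₂(2⁸3⁶)/16 ≈ 2.9056`. -/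
def witA : PolyMapF2 4 :=
  [[[0, 1], [2], [0, 2], [1, 2], [1, 3]], [[], [2], [3]], [[1, 2], [0, 3], [1, 3], [2, 3]],
    [[0], [0, 1], [1, 2], [3], [0, 3], [1, 3]]]

/-- `B = (x₀ + x₁ + x₃, x₀ + x₁ + x₀x₁ + x₁x₂ + x₁x₃ + x₂x₃, 1 + x₁ + x₁x₂ + x₃ + x₀x₃,
1 + x₁ + x₀x₂ + x₀x₃ + x₁x₃)`, `H = 4 − log₂(5⁵)/16 ≈ 3.2744`. -/
def witB : PolyMapF2 4 :=
  [[[0], [1], [3]], [[0], [1], [0, 1], [1, 2], [1, 3], [2, 3]], [[], [1], [1, 2], [3], [0, 3]],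
    [[], [1], [0, 2], [0, 3], [1, 3]]]

/-- `A` is quadratic. [folklore] -/
theorem witA_degLE : witA.DegLE 2 := by decide
/-- `B` is quadratic. [folklore] -/
theorem witB_degLE : witB.DegLE 2 := by decide
/-- `A` and `B` have the same signed bias census (16 members, by evaluation). [folklore] -/
theorem census_witA_eq_witB : census witA = census witB := by native_decide
/-- `Π(A) = 2⁸·3⁶` (fibre profile 1,1,2,2,2,2,3,3). [folklore] -/
theorem fiberProd_witA : fiberProd witA = 2 ^ 8 * 3 ^ 6 := by native_decide
/-- `Π(B) = 5⁵` (fibre profile 1×11, 5). [folklore] -/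
theorem fiberProd_witB : fiberProd witB = 5 ^ 5 := by native_decide

/-- Base gap: `17/48 < H(B) − H(A)` (true value 0.36878…; census-equivalent, both quadratic). -/
theorem entropy_gap_AB : (17 : ℝ) / 48 < witB.entropy - witA.entropy := by
  have h : 2 ^ 17 * fiberProd witB ^ 3 < fiberProd witA ^ 3 := by
    rw [fiberProd_witA, fiberProd_witB]; norm_num
  have := entropy_gap_of_fiberProd_pow (by norm_num) h
  norm_num at this ⊢
  linarith

/-! ### 4.2 Sparse witness pair on `n = 8`, `m = 6` (structured search `py/search2.py`, seed 26) -/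

/-- `P₁ = (x₄x₇ + x₇, x₃, x₀x₄, x₄, x₃x₄ + x₀, 1 + x₀x₃)`: `Π = 2^1152`, so `H = 7/2` EXACTLY. -/
def witP1 : PolyMapF2 8 :=
  [[[4, 7], [7]], [[3]], [[0, 4]], [[4]], [[3, 4], [0]], [[], [0, 3]]]

/-- `P₄ = (x₀x₅, x₀x₂, x₀x₆ + 1, x₄ + x₂x₇, x₄x₇ + 1, x₀x₃ + x₀x₅)`: `H ≈ 4.49346`. -/
def witP4 : PolyMapF2 8 :=
  [[[0, 5]], [[0, 2]], [[0, 6], []], [[4], [2, 7]], [[4, 7], []], [[0, 3], [0, 5]]]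

/-- `P₁` is quadratic. [folklore] -/
theorem witP1_degLE : witP1.DegLE 2 := by decide
/-- `P₄` is quadratic. [folklore] -/
theorem witP4_degLE : witP4.DegLE 2 := by decide
/-- `P₁` and `P₄` have the same signed bias census (64 members, by evaluation). [folklore] -/
theorem census_witP1_eq_witP4 : census witP1 = census witP4 := by native_decide
/-- `Π(P₁) = 2^1152` (fibre profile 8×16, 4×32). [folklore] -/
theorem fiberProd_witP1 : fiberProd witP1 = 2 ^ 1152 := by native_decide
/-- `H(P₁(U₈)) = 7/2` exactly. [folklore] -/
theorem entropy_witP1 : witP1.entropy = 7 / 2 := by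
  rw [entropy_of_fiberProd_eq_two_pow fiberProd_witP1]; norm_num
/-- `2^254 · Π(P₄) < Π(P₁)` (by evaluation), i.e. `H(P₄) − H(P₁) > 254/256`. [folklore] -/
theorem fiberProd_witP4_lt : 2 ^ 254 * fiberProd witP4 < fiberProd witP1 := by native_decide

/-- Sparse gap: `127/128 < H(P₄) − H(P₁)` (true value 0.99346…). -/
theorem entropy_gap_P14 : (127 : ℝ) / 128 < witP4.entropy - witP1.entropy := by
  have h := entropy_gap_of_fiberProd fiberProd_witP4_lt
  have e : ((254 : ℕ) : ℝ) / 2 ^ 8 = 127 / 128 := by norm_num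
  rw [e] at h
  exact h

/-! ### 4.3 Gap larger than one bit: direct sums `C = P₁ × A`, `D = P₄ × B` on `n = 12`, `m = 10` -/

/-- `C = P₁ × A` (disjoint variable blocks). -/
def witC : PolyMapF2 12 := witP1.prod witA
/-- `D = P₄ × B`. -/
def witD : PolyMapF2 12 := witP4.prod witB

/-- `C` is quadratic. [folklore] -/
theorem witC_degLE : witC.DegLE 2 := witP1_degLE.prod witA_degLE
/-- `D` is quadratic. [folklore] -/
theorem witD_degLE : witD.DegLE 2 := witP4_degLE.prod witB_degLE

/-- **Census-equivalent quadratic maps on 12 variables** (1024 pencil members × 4096 points, by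
evaluation). -/
theorem census_witC_eq_witD : census witC = census witD := by native_decide

/-- **… whose Shannon entropies differ by more than one bit**: `1 < 127/128 + 17/48 < H(D) − H(C)`
(true values `H(C) = 6.40564…`, `H(D) = 7.76786…`).  Hence NO function of the bias/rank/Arf census
of the pencil approximates the Shannon entropy of quadratic maps to within `1/2`, and none decides
`PEA₂` (after an integer shift of thresholds by padding, cf. REMARK 4.8). -/
theorem one_lt_entropy_gap_CD : (1 : ℝ) < witD.entropy - witC.entropy := by
  have h1 := entropy_gap_P14
  have h2 := entropy_gap_AB
  simp only [witC, witD, entropy_prod]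
  linarith

/-- Packaged: census-equivalent quadratic maps with Shannon entropies more than one bit apart exist. -/
theorem census_does_not_determine_entropy :
    ∃ n : ℕ, ∃ C D : PolyMapF2 n, C.DegLE 2 ∧ D.DegLE 2 ∧ census C = census D ∧
      1 < D.entropy - C.entropy :=
  ⟨12, witC, witD, witC_degLE, witD_degLE, census_witC_eq_witD, one_lt_entropy_gap_CD⟩

/-! ### 4.7 Amplification, machine-checked: the census is multiplicative under direct products -/

variable {n' : ℕ}

/-- Length-explicit census. -/
def census' (m : ℕ) (O : Multiset (List (ZMod 2))) : Multiset ℤ :=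
  (Finset.univ : Finset (Fin m → ZMod 2)).val.map fun c => intBias O (List.ofFn c)

theorem census_eq_census' (P : PolyMapF2 n) : census P = census' P.length (outputs P) := rfl

/-- The product of two censuses: multiset of pairwise products. -/
def mulCensus (C D : Multiset ℤ) : Multiset ℤ := (C ×ˢ D).map fun p => p.1 * p.2

def sgn (t : ZMod 2) : ℤ := if t = 0 then 1 else -1

theorem sgn_add (a b : ZMod 2) : sgn (a + b) = sgn a * sgn b := by
  fin_cases a <;> fin_cases b <;> rfl

theorem dotL_append {cl₁ cl₂ l₁ l₂ : List (ZMod 2)} (h : cl₁.length = l₁.length) :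
    dotL (cl₁ ++ cl₂) (l₁ ++ l₂) = dotL cl₁ l₁ + dotL cl₂ l₂ := by
  unfold dotL
  rw [List.zipWith_append h, List.sum_append]

theorem intBias_outputs (P : PolyMapF2 n) (cl : List (ZMod 2)) :
    intBias (outputs P) cl = ∑ x : Fin n → ZMod 2, sgn (dotL cl (P.eval x)) := by
  unfold intBias outputs sgn
  rw [Multiset.map_map]
  rfl

/-- Bias of an appended character on a direct product = product of the biases. -/
theorem intBias_prod (P : PolyMapF2 n) (Q : PolyMapF2 n') {cl₁ cl₂ : List (ZMod 2)}
    (h : cl₁.length = P.length) :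
    intBias (outputs (P.prod Q)) (cl₁ ++ cl₂) =
      intBias (outputs P) cl₁ * intBias (outputs Q) cl₂ := by
  rw [intBias_outputs, intBias_outputs, intBias_outputs, Finset.sum_mul_sum,
    ← Finset.sum_product', Finset.univ_product_univ, ← Equiv.sum_comp (Fin.appendEquiv n n')]
  refine Finset.sum_congr rfl fun x _ => ?_
  obtain ⟨x₁, x₂⟩ := x
  rw [← sgn_add]
  have hl : cl₁.length = (P.eval x₁).length := by rw [length_eval, h]
  rw [← dotL_append hl]
  congr 2
  simp [eval_prod]

/-- Reindexing `univ.val.map` along an equivalence. -/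
theorem univ_val_map_equiv {α β γ : Type*} [Fintype α] [Fintype β] (e : α ≃ β) (F : β → γ) :
    (Finset.univ : Finset β).val.map F = (Finset.univ : Finset α).val.map (F ∘ e) := by
  have h : (Finset.univ : Finset α).val.map e = (Finset.univ : Finset β).val := by
    have h' := congrArg Finset.val (Finset.map_univ_equiv e)
    rwa [Finset.map_val, Equiv.coe_toEmbedding] at h'
  rw [← Multiset.map_map, h]

/-- Interchanging `map` with the multiset product. -/
theorem map_mul_product_map {α β : Type*} (s : Multiset α) (t : Multiset β) (f : α → ℤ) (g : β → ℤ) :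
    ((s.map f) ×ˢ (t.map g)).map (fun p => p.1 * p.2) = (s ×ˢ t).map (fun p => f p.1 * g p.2) := by
  induction s using Multiset.induction_on with
  | empty => simp
  | cons a s ih =>
    rw [Multiset.map_cons, Multiset.cons_product, Multiset.cons_product, Multiset.map_add,
      Multiset.map_add, ih, Multiset.map_map, Multiset.map_map, Multiset.map_map]
    rfl

/-- **Census of a direct product is the product of the censuses.** -/
theorem census_prod (P : PolyMapF2 n) (Q : PolyMapF2 n') :
    census (P.prod Q) = mulCensus (census P) (census Q) := by
  rw [census_eq_census', length_prod, census_eq_census', census_eq_census']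
  unfold census' mulCensus
  rw [univ_val_map_equiv (Fin.appendEquiv P.length Q.length), map_mul_product_map,
    ← Finset.product_val, Finset.univ_product_univ]
  refine Multiset.map_congr rfl fun cc _ => ?_
  obtain ⟨c₁, c₂⟩ := cc
  show intBias (outputs (P.prod Q)) (List.ofFn (Fin.append c₁ c₂)) =
    intBias (outputs P) (List.ofFn c₁) * intBias (outputs Q) (List.ofFn c₂)
  rw [List.ofFn_fin_append]
  exact intBias_prod P Q (by simp)

/-- Census-equivalence is preserved by direct products. -/
theorem census_prod_congr {P P' : PolyMapF2 n} {Q Q' : PolyMapF2 n'} (hP : census P = census P')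
    (hQ : census Q = census Q') : census (P.prod Q) = census (P'.prod Q') := by
  rw [census_prod, census_prod, hP, hQ]


/-! ### Iterated direct powers and unbounded census-equivalent entropy gaps -/

/-- `t`-fold direct power `P × ⋯ × P` on `n·t` variables. -/
def pow (P : PolyMapF2 n) : (t : ℕ) → PolyMapF2 (n * t)
  | 0 => []
  | t + 1 => (pow P t).prod P

theorem pow_degLE {d : ℕ} {P : PolyMapF2 n} (h : P.DegLE d) : ∀ t, (pow P t).DegLE d
  | 0 => degLE_nil d
  | t + 1 => (pow_degLE h t).prod h

theorem entropy_pow (P : PolyMapF2 n) : ∀ t : ℕ, (pow P t).entropy = t * P.entropy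
  | 0 => by simp [pow, entropy_nil]
  | t + 1 => by
    rw [pow, entropy_prod, entropy_pow P t]
    push_cast
    ring

theorem census_pow_congr {P P' : PolyMapF2 n} (h : census P = census P') :
    ∀ t : ℕ, census (pow P t) = census (pow P' t)
  | 0 => rfl
  | t + 1 => census_prod_congr (census_pow_congr h t) h

/-- **Amplification**: from one census-equivalent pair with entropy gap `> δ`, census-equivalent
pairs with gap `> t·δ` for every `t`. -/
theorem census_gap_amplify {P P' : PolyMapF2 n} (hc : census P = census P') {δ : ℝ}
    (hgap : δ < P'.entropy - P.entropy) (t : ℕ) :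
    census (pow P t) = census (pow P' t) ∧ (t : ℝ) * δ ≤ (pow P' t).entropy - (pow P t).entropy := by
  refine ⟨census_pow_congr hc t, ?_⟩
  rw [entropy_pow, entropy_pow, ← mul_sub]
  exact mul_le_mul_of_nonneg_left hgap.le (Nat.cast_nonneg t)


/-- **Census-equivalent quadratic maps have UNBOUNDED Shannon-entropy gaps**: for every `T`, powers
of `witA`/`witB` (gap 17/48 per factor) are census-equivalent quadratic maps with gap `> T`.  No
function of the rank/type/bias census approximates the entropy to within ANY additive constant. -/
theorem census_equivalent_gap_unbounded (T : ℕ) :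
    ∃ N : ℕ, ∃ C D : PolyMapF2 N, C.DegLE 2 ∧ D.DegLE 2 ∧ census C = census D ∧
      (T : ℝ) < D.entropy - C.entropy := by
  obtain ⟨hc, hgap⟩ := census_gap_amplify census_witA_eq_witB entropy_gap_AB (3 * T + 3)
  refine ⟨4 * (3 * T + 3), pow witA (3 * T + 3), pow witB (3 * T + 3), pow_degLE witA_degLE _,
    pow_degLE witB_degLE _, hc, lt_of_lt_of_le ?_ hgap⟩
  push_cast
  nlinarith

/-! REMARK 4.8 (padding and search statistics).
(a) By padding both maps of a census-equivalent pair with the same product of fresh gadgets (x·y: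
+0.8113 bits; (xy, xz): +1.5488 bits; a fresh linear output: +1) the two entropies can be placed on
opposite sides of an integer threshold pair (k, k+1) (census-equivalence is preserved by
`census_prod_congr`): census-reading algorithms fail on actual PEA₂ instances, not only on the
real-valued functional.
(b) Searched maxima of the single-pair gap (random sparse maps, 10⁵–4·10⁵ trials each): n=4,m=4: 0.37;
n=6,m=5: 0.64; n=7,m=6: 0.79; n=8,m=6: 0.9935; n=8,m=8: 0.88; n=9,m=7: 0.91; n=10,m=8: 0.75 (under-
sampled).  Within census classes of RANDOM dense maps (n = m = 5, 6) spreads of 0.2–0.37 are typical: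
the phenomenon is generic, not a curiosity of sparse maps. -/

/-! ## §5 Shannon versus Rényi entropy for quadratic maps over F₂ -/

/-- The planner's family `(x₀, x₀x₁, …, x₀x_{m-1})` on `n = m` variables, here `m = 7`. -/
def renyiFamily7 : PolyMapF2 7 :=
  [[[0]], [[0, 1]], [[0, 2]], [[0, 3]], [[0, 4]], [[0, 5]], [[0, 6]]]

/-- Collision count `#{(x, x') : P x = P x'} = Σ_x |fibre(x)| = 2^{2n} · 2^{-H₂(P(U_n))}`. -/
def collisionCount (P : PolyMapF2 n) : ℕ :=
  ∑ x : Fin n → ZMod 2, (fiber Finset.univ P.eval (P.eval x)).card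

/-- The family member is quadratic. [folklore] -/
theorem renyiFamily7_degLE : renyiFamily7.DegLE 2 := by decide
/-- `Π = 2^384` (64 points with fibre 64, 64 singletons). [folklore] -/
theorem fiberProd_renyiFamily7 : fiberProd renyiFamily7 = 2 ^ 384 := by native_decide
/-- `H(renyiFamily7) = 4` exactly (= (m+1)/2 at m = 7). -/
theorem entropy_renyiFamily7 : renyiFamily7.entropy = 4 := by
  rw [entropy_of_fiberProd_eq_two_pow fiberProd_renyiFamily7]; norm_num
/-- Collision count `4160 = 2^14 · (1/4 + 2^{-8})`, i.e. `H₂ = 14 − log₂ 4160 = 1.977… < 2 < H/2`: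
the instance lies outside BOTH sides of DGRV's promise 'H_Shannon < k vs H_Rényi ≥ 2k+1' for every k,
and in the family `H = (m+1)/2 → ∞` while `H₂ ↑ 2` — Rényi-type statistics (directional-derivative
ranks, second moments of biases) cannot approximate Shannon entropy of quadratic maps over F₂ to any
additive constant. [DGRV 2010, Thm 5.3, Claim 5.6] -/
theorem collisionCount_renyiFamily7 : collisionCount renyiFamily7 = 4160 := by native_decide

/-! ## §6 Signed one-step degree reduction: eliminating a cubic monomial exactly, with signs -/

/-! ### 6.0 The one-step elimination identity (1), proved in general

For `R : PolyMapF2 n` (the map with the cubic occurrence removed), coordinate `i`, variables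
`a b c : Fin n`: `pOf R i a b c = R + x_a x_b x_c · e_i`, `p'Of = pOf + x_a · e_i`, and the gadget
`gadget R i a b c` on `n + 1` variables, QUADRATIC in the treated monomial (fresh variable `0 =: w`;
`x_a · w` added to coordinate `i`, extra output `w + x_b x_c`).  `entropy_gadget`:
`H(gadget) = 1 + (H(pOf) + H(p'Of))/2` — identity (1) of REMARK 6.1 for `u = x_a` (the other six `u`
follow by first rewriting `x_a x_b x_c = u · x_κ + [odd overlap] x_κ`), via the general tagged-mixture
rule `mapEntropy_tagged` and the measure-preserving shear `(x, z) ↦ (z + x_b x_c, x)`. -/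

/-- Add the monomial `μ` to coordinate `i` of `P`. [folklore] -/
def addMon (P : PolyMapF2 n) (i : ℕ) (μ : List (Fin n)) : PolyMapF2 n :=
  P.modify i (fun poly => μ :: poly)

/-- Lift a map on `n` variables to `n+1` variables along `Fin.succ` (the new variable `0` unused). [folklore] -/
def lift (P : PolyMapF2 n) : PolyMapF2 (n + 1) :=
  P.map (List.map (List.map Fin.succ))

/-- The gadget `q_u` for `u = x_a`: `R` lifted, `x_a · w` added to coordinate `i`, and the extra output
`w + x_b x_c` (`w` = variable `0`). [folklore] -/
def gadget (R : PolyMapF2 n) (i : ℕ) (a b c : Fin n) : PolyMapF2 (n + 1) :=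
  addMon (lift R) i [a.succ, 0] ++ [[[0], [b.succ, c.succ]]]

/-- `p = R + x_a x_b x_c e_i`. [folklore] -/
def pOf (R : PolyMapF2 n) (i : ℕ) (a b c : Fin n) : PolyMapF2 n := addMon R i [a, b, c]

/-- `p' = p + x_a e_i`. [folklore] -/
def p'Of (R : PolyMapF2 n) (i : ℕ) (a b c : Fin n) : PolyMapF2 n := addMon (pOf R i a b c) i [a]

/-! ### evaluation lemmas -/

/-- Evaluation of `addMon`: the value of coordinate `i` gains the monomial's value. [folklore] -/
theorem eval_addMon (P : PolyMapF2 n) (i : ℕ) (μ : List (Fin n)) (x : Fin n → ZMod 2) :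
    (addMon P i μ).eval x = (P.eval x).modify i (fun t => (μ.map x).prod + t) := by
  induction P generalizing i with
  | nil => simp [addMon, eval]
  | cons poly P ih =>
    cases i with
    | zero => simp [addMon, eval]
    | succ i =>
      have := ih i
      simp only [addMon, eval, List.map_cons, List.modify_succ_cons] at this ⊢
      exact congrArg _ this

/-- Evaluation of `lift`: the lifted map ignores variable `0`. [folklore] -/
theorem eval_lift (P : PolyMapF2 n) (y : Fin (n + 1) → ZMod 2) :
    (lift P).eval y = P.eval (Fin.tail y) := by
  simp only [lift, eval, List.map_map, Function.comp_def]
  rfl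

/-- Evaluation of an appended map is the appended evaluation. [folklore] -/
theorem eval_append (P Q : PolyMapF2 n) (x : Fin n → ZMod 2) :
    (P ++ Q : PolyMapF2 n).eval x = P.eval x ++ Q.eval x := by
  simp [eval]

/-! ### A general "tagged mixture" entropy rule -/

section Tagged

variable {ι β : Type*} [DecidableEq β]

/-- **Entropy of a tagged mixture over a revealed uniform bit**: for two maps `f 0, f 1 : ι → β` on
the same nonempty sample space `S`, the map `(v, z) ↦ (f z v, z)` on `S × F₂` has entropy
`1 + (H(f 0) + H(f 1))/2` (chain rule: the tag is uniform and revealed).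
[CoverThomas2006, Thm 2.2.1 (chain rule)] -/
theorem mapEntropy_tagged {S : Finset ι} (hS : S.Nonempty) (f : ZMod 2 → ι → β) :
    mapEntropy (S ×ˢ (Finset.univ : Finset (ZMod 2))) (fun p : ι × ZMod 2 => (f p.2 p.1, p.2)) =
      1 + (mapEntropy S (f 0) + mapEntropy S (f 1)) / 2 := by
  classical
  have hScard : (0 : ℝ) < S.card := by exact_mod_cast Finset.card_pos.2 hS
  -- fibres of the tagged map
  have hfib : ∀ p ∈ S ×ˢ (Finset.univ : Finset (ZMod 2)),
      fiber (S ×ˢ (Finset.univ : Finset (ZMod 2))) (fun p : ι × ZMod 2 => (f p.2 p.1, p.2))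
          (f p.2 p.1, p.2) = (fiber S (f p.2) (f p.2 p.1)) ×ˢ {p.2} := by
    intro p _
    ext q
    obtain ⟨v, z⟩ := q
    simp only [mem_fiber, Finset.mem_product, Finset.mem_univ, and_true, Prod.mk.injEq,
      Finset.mem_singleton]
    constructor
    · rintro ⟨hv, hf, rfl⟩
      exact ⟨⟨hv, hf⟩, rfl⟩
    · rintro ⟨⟨hv, hf⟩, rfl⟩
      exact ⟨hv, hf, rfl⟩
  have hcardSU : (((S ×ˢ (Finset.univ : Finset (ZMod 2))).card : ℕ) : ℝ) = 2 * S.card := by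
    rw [Finset.card_product, Finset.card_univ, ZMod.card]
    push_cast
    ring
  have hcardF : ∀ p : ι × ZMod 2,
      ((((fiber S (f p.2) (f p.2 p.1)) ×ˢ ({p.2} : Finset (ZMod 2))).card : ℕ) : ℝ) =
        (fiber S (f p.2) (f p.2 p.1)).card := by
    intro p
    rw [Finset.card_product, Finset.card_singleton, mul_one]
  have hterm : ∀ p ∈ S ×ˢ (Finset.univ : Finset (ZMod 2)),
      Real.logb 2 ((2 * S.card : ℝ) / (fiber S (f p.2) (f p.2 p.1)).card) =
        1 + Real.logb 2 ((S.card : ℝ) / (fiber S (f p.2) (f p.2 p.1)).card) := by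
    intro p hp
    have hv : p.1 ∈ S := (Finset.mem_product.1 hp).1
    have hc : (0 : ℝ) < (fiber S (f p.2) (f p.2 p.1)).card := by
      exact_mod_cast card_fiber_pos (f p.2) hv
    rw [mul_div_assoc, Real.logb_mul two_ne_zero (div_pos hScard hc).ne',
      Real.logb_self_eq_one one_lt_two]
  unfold mapEntropy
  rw [Finset.sum_congr rfl fun p hp => by rw [hfib p hp, hcardF p]]
  simp only [hcardSU]
  rw [Finset.sum_congr rfl hterm, Finset.sum_add_distrib, Finset.sum_const, nsmul_eq_mul, mul_one,
    hcardSU, Finset.sum_product_right,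
    show (Finset.univ : Finset (ZMod 2)) = {0, 1} from by decide, Finset.sum_pair (by decide)]
  field_simp
  try ring

end Tagged

/-! ### The identity -/

/-- `v + v = 0` in `F₂`. [folklore] -/
theorem add_self_zmod2 (v : ZMod 2) : v + v = 0 := by
  fin_cases v <;> rfl

/-- The shear `(x, z) ↦ cons (z + x_b x_c) x` identifying `F₂ⁿ × F₂` with `F₂^{n+1}`. [folklore] -/
def shear (b c : Fin n) : (Fin n → ZMod 2) × ZMod 2 ≃ (Fin (n + 1) → ZMod 2) where
  toFun p := Fin.cons (p.2 + p.1 b * p.1 c) p.1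
  invFun y := (Fin.tail y, y 0 + y b.succ * y c.succ)
  left_inv p := by
    obtain ⟨x, z⟩ := p
    simp only [Fin.tail_cons, Fin.cons_zero, Fin.cons_succ, Prod.mk.injEq, true_and]
    rw [add_assoc, add_self_zmod2, add_zero]
  right_inv y := by
    show Fin.cons ((y 0 + y b.succ * y c.succ) + Fin.tail y b * Fin.tail y c) (Fin.tail y) = y
    have : (y 0 + y b.succ * y c.succ) + Fin.tail y b * Fin.tail y c = y 0 := by
      simp only [Fin.tail]
      rw [add_assoc, add_self_zmod2, add_zero]
    rw [this, Fin.cons_self_tail]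

/-- Unfolding `shear`. [folklore] -/
theorem shear_apply (b c : Fin n) (x : Fin n → ZMod 2) (z : ZMod 2) :
    shear b c (x, z) = Fin.cons (z + x b * x c) x := rfl

/-- The two perturbations of `R`, indexed by the tag `z`: `p` for `z = 0`, `p'` for `z = 1`. [folklore] -/
def pz (R : PolyMapF2 n) (i : ℕ) (a b c : Fin n) (z : ZMod 2) : PolyMapF2 n :=
  if z = 0 then pOf R i a b c else p'Of R i a b c

/-- Pointwise: on `shear (x, z)` the gadget outputs `p_z(x)` followed by the tag `z`. [folklore] -/
theorem eval_gadget_shear (R : PolyMapF2 n) (i : ℕ) (a b c : Fin n) (x : Fin n → ZMod 2)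
    (z : ZMod 2) :
    (gadget R i a b c).eval (shear b c (x, z)) = (pz R i a b c z).eval x ++ [z] := by
  unfold gadget
  rw [eval_append, eval_addMon, eval_lift, shear_apply, Fin.tail_cons]
  congr 1
  · have hz01 : ∀ z : ZMod 2, z = 0 ∨ z = 1 := by decide
    obtain rfl | rfl := hz01 z
    · show _ = (pz R i a b c 0).eval x
      simp only [pz, if_true, pOf, eval_addMon]
      congr 1
      funext t
      simp only [List.map_cons, List.map_nil, List.prod_cons, List.prod_nil, mul_one, Fin.cons_succ,
        Fin.cons_zero]
      ring
    · show _ = (pz R i a b c 1).eval x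
      simp only [pz, one_ne_zero, if_false, p'Of, pOf, eval_addMon, List.modify_modify_eq]
      congr 1
      funext t
      simp only [Function.comp, List.map_cons, List.map_nil, List.prod_cons, List.prod_nil, mul_one,
        Fin.cons_succ, Fin.cons_zero]
      ring
  · simp only [eval, List.map_cons, List.map_nil, List.prod_cons, List.prod_nil, mul_one,
      List.sum_cons, List.sum_nil, add_zero, Fin.cons_zero, Fin.cons_succ, List.cons.injEq, and_true]
    rw [add_assoc, add_self_zmod2, add_zero]

/-- **The one-step elimination identity (1)**: `H(q_{x_a}) = 1 + (H(p) + H(p + x_a e_i))/2`, for every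
rest map `R`, coordinate `i` and variables `a, b, c`. [folklore] -/
theorem entropy_gadget (R : PolyMapF2 n) (i : ℕ) (a b c : Fin n) :
    (gadget R i a b c).entropy = 1 + ((pOf R i a b c).entropy + (p'Of R i a b c).entropy) / 2 := by
  unfold PolyMapF2.entropy
  rw [← Literature.InformationTheory.Entropy.mapEntropy_univ_comp_equiv (shear b c)]
  have h1 : (gadget R i a b c).eval ∘ (shear b c) =
      (fun l : List (ZMod 2) × ZMod 2 => l.1 ++ [l.2]) ∘
        (fun p : (Fin n → ZMod 2) × ZMod 2 => ((pz R i a b c p.2).eval p.1, p.2)) := by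
    funext p
    obtain ⟨x, z⟩ := p
    simp only [Function.comp_apply, eval_gadget_shear]
  have hinj : ∀ p ∈ (Finset.univ : Finset ((Fin n → ZMod 2) × ZMod 2)),
      ∀ p' ∈ (Finset.univ : Finset ((Fin n → ZMod 2) × ZMod 2)),
      (fun l : List (ZMod 2) × ZMod 2 => l.1 ++ [l.2]) ((pz R i a b c p.2).eval p.1, p.2) =
        (fun l : List (ZMod 2) × ZMod 2 => l.1 ++ [l.2]) ((pz R i a b c p'.2).eval p'.1, p'.2) →
      ((pz R i a b c p.2).eval p.1, p.2) = ((pz R i a b c p'.2).eval p'.1, p'.2) := by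
    intro p _ p' _ h
    obtain ⟨h₁, h₂⟩ := List.append_inj' h rfl
    exact Prod.ext h₁ (by simpa using h₂)
  rw [h1, Literature.InformationTheory.Entropy.mapEntropy_comp_of_injOn _ _ hinj,
    ← Finset.univ_product_univ,
    show (fun p : (Fin n → ZMod 2) × ZMod 2 => ((pz R i a b c p.2).eval p.1, p.2)) =
      (fun p => ((fun z v => (pz R i a b c z).eval v) p.2 p.1, p.2)) from rfl,
    mapEntropy_tagged (f := fun z v => (pz R i a b c z).eval v) Finset.univ_nonempty]
  simp [pz]


/-! REMARK 6.1 (theorem on paper, all steps elementary; instance machine-checked below).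
Let `p : F₂ⁿ → F₂ᵐ` have the cubic monomial `μ = x_a x_b x_c` occurring once in coordinate `i`.
For a nonzero linear form `u ∈ W := ⟨x_a, x_b, x_c⟩` pick a 2-subset `κ ⊂ {a,b,c}` whose complement
variable occurs in `u` (always possible) and put, with ONE fresh variable `w`,
  `q_u := p` with `μ` replaced in coordinate `i` by `u·w + [#(u ∩ κ) odd]·x_κ`, plus the new output
  `w + x_κ`.
Then `(x, w) ↦ (x, z := w + x_κ)` is a bijection of `F₂^{n+1}` under which `q_u = (p(x) + z·u·e_i, z)`,
so   `H(q_u) = 1 + ½·H(p) + ½·H(p + u e_i)`.                                            (1)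
With THREE fresh variables, `q_W := p` with `μ` replaced by `x_a w₁ + x_b w₂ + x_c w₃` plus outputs
`w₁ + x_b x_c, w₂ + x_a x_c, w₃ + x_a x_b` gives `q_W ≅ (p(x) + (z₁x_a + z₂x_b + z₃x_c) e_i, z)`, so
     `H(q_W) = 3 + ⅛ Σ_{v ∈ W} H(p + v e_i)`.                                            (2)
Summing (1) over the 7 nonzero `u` and subtracting (2):
     `H(p) = ⅓ Σ_{u ≠ 0} H(q_u) − (4/3) H(q_W) + 5/3`,                                    (3)
equivalently, with `Π` the fibre product (`H = n − log₂ Π / 2ⁿ`):  `Π(p)⁶ · Π(q_W) = ∏_{u≠0} Π(q_u)`.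
All eight maps have the occurrence of `μ` removed and every other monomial unchanged (degree ≤ 2 in
the fresh variables), so T occurrences are removed by 8^T maps with coefficient ℓ₁-mass (11/3)^T.
(The coefficients (7 × ⅓, −4/3) realise the point evaluation δ₀ on functions `W → ℝ` from uniform
averages over nonzero subspaces — lines and W; using planes instead costs ℓ₁-mass 13.  Uniform
subspace averages containing 0 are all a degree-2 gadget can produce, which is why the signs — hence
a PED-type (difference) rather than PEA-type use of the oracle, and the 8^T blow-up — appear.) -/

/-- The cubic test map `p = (x₀x₁x₂)` on `n = 3`. -/
def cub : PolyMapF2 3 := [[[0, 1, 2]]]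
/-- `q_u` for `u = x₀` (cofactor x₁x₂): `(x₀w, w + x₁x₂)`. -/
def q100 : PolyMapF2 4 := [[[0, 3]], [[3], [1, 2]]]
/-- `u = x₁` (cofactor x₀x₂). -/
def q010 : PolyMapF2 4 := [[[1, 3]], [[3], [0, 2]]]
/-- `u = x₂` (cofactor x₀x₁). -/
def q001 : PolyMapF2 4 := [[[2, 3]], [[3], [0, 1]]]
/-- `u = x₀ + x₁` (cofactor x₁x₂, odd overlap ⇒ correction `+ x₁x₂`). -/
def q110 : PolyMapF2 4 := [[[0, 3], [1, 3], [1, 2]], [[3], [1, 2]]]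
/-- `u = x₀ + x₂` (cofactor x₁x₂, correction `+ x₁x₂`). -/
def q101 : PolyMapF2 4 := [[[0, 3], [2, 3], [1, 2]], [[3], [1, 2]]]
/-- `u = x₁ + x₂` (cofactor x₀x₂, correction `+ x₀x₂`). -/
def q011 : PolyMapF2 4 := [[[1, 3], [2, 3], [0, 2]], [[3], [0, 2]]]
/-- `u = x₀ + x₁ + x₂` (cofactor x₁x₂, even overlap ⇒ no correction). -/
def q111 : PolyMapF2 4 := [[[0, 3], [1, 3], [2, 3]], [[3], [1, 2]]]
/-- `q_W`: `(x₀w₁ + x₁w₂ + x₂w₃, w₁ + x₁x₂, w₂ + x₀x₂, w₃ + x₀x₁)`. -/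
def qW : PolyMapF2 6 := [[[0, 3], [1, 4], [2, 5]], [[3], [1, 2]], [[4], [0, 2]], [[5], [0, 1]]]

/-- The seven `q_u`, indexed. -/
def qu : Fin 7 → PolyMapF2 4 := ![q100, q010, q001, q110, q101, q011, q111]

/-- All eight gadget maps are QUADRATIC. [folklore] -/
theorem gadgets_degLE : (∀ u, (qu u).DegLE 2) ∧ qW.DegLE 2 := by decide

/-- **The signed degree-reduction identity, integer form, for `p = x₀x₁x₂`**:
`Π(p)⁶ · Π(q_W) = ∏_u Π(q_u)` — i.e. `H(x₀x₁x₂) = h(1/8) = ⅓ Σ_u H(q_u) − (4/3) H(q_W) + 5/3` with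
eight QUADRATIC maps. -/
theorem gadget_identity_x012 : fiberProd cub ^ 6 * fiberProd qW = ∏ u, fiberProd (qu u) := by
  native_decide

/-- The same identity read in entropies (an exact real identity for this instance). -/
theorem gadget_identity_x012_entropy :
    cub.entropy = (∑ u, (qu u).entropy) / 3 - 4 / 3 * qW.entropy + 5 / 3 := by
  have ha : (0 : ℝ) < fiberProd cub := by exact_mod_cast fiberProd_pos cub
  have hb : (0 : ℝ) < fiberProd qW := by exact_mod_cast fiberProd_pos qW
  have hc : ∀ u ∈ (Finset.univ : Finset (Fin 7)), (fiberProd (qu u) : ℝ) ≠ 0 := fun u _ => by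
    exact_mod_cast (fiberProd_pos (qu u)).ne'
  have hR : (fiberProd cub : ℝ) ^ 6 * fiberProd qW = ∏ u, (fiberProd (qu u) : ℝ) := by
    exact_mod_cast gadget_identity_x012
  have key : 6 * Real.logb 2 (fiberProd cub) + Real.logb 2 (fiberProd qW) =
      ∑ u, Real.logb 2 (fiberProd (qu u)) := by
    have := congrArg (Real.logb 2) hR
    rwa [Real.logb_mul (pow_ne_zero _ ha.ne') hb.ne', Real.logb_pow, Real.logb_prod _ _ hc] at this
  have hsum : ∑ u, (qu u).entropy = 7 * 4 - (∑ u, Real.logb 2 (fiberProd (qu u))) / 2 ^ 4 := by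
    simp only [entropy_eq_sub_logb_fiberProd, Finset.sum_sub_distrib, Finset.sum_const,
      Finset.card_univ, Fintype.card_fin, nsmul_eq_mul, Finset.sum_div]
    push_cast
    ring
  rw [hsum, entropy_eq_sub_logb_fiberProd, entropy_eq_sub_logb_fiberProd]
  push_cast
  linarith [key]

/-! REMARK 6.2 (consequences).  (i) If `PEA 2 ∈ PromiseBPP'` then entropies of quadratic maps are
approximable to additive `1/t` in randomized time poly(size·t) (query the decider on `q^{×t}` —
`entropy_prod` — for each threshold k and locate the flip), so by (3) iterated, entropies of cubic maps
with T cubic monomial occurrences are approximable in time poly · 8^T · (11/3)^{T}: for every c,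
`PEA₃ ∩ {≤ c log n cubic occurrences} ∈ prBPP`.  Degree-3 hardness (thesis X, DGRV Thm 4.7 via IK
randomizing polynomials, which have poly(n) cubic monomials r·x·r') is untouched, but any proof of X
must use ω(log n) cubic terms in an essential way, and any algorithm for the crux is automatically an
algorithm for "almost quadratic" cubic maps.  (ii) (1) alone says: the average ½H(p) + ½H(p + u eᵢ) over
a linear perturbation of one coordinate is a quadratic-map entropy; a cubic map whose designated linear
factors are also OUTPUT coordinates (p_j = x_a for some j) has `H(p + x_a e_i) = H(p)` (output shear), so
such "transparent" cubic maps Karp-reduce to PEA₂ exactly — but their entropy is `|y| + E_y H(Q_y)`, an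
average of quadratic entropies, so they carry no new hardness.  (iii) Whether a sign-free gadget exists
(a genuine Karp reduction PEA₃ ≤ PEA₂, which would make the crux EQUIVALENT to the kill switch and to
SZK_L ⊆ BPP) is the sharpest open question this file isolates; by IK00/AIK06 no degree-2 perfectly or
statistically private randomized encoding of general functions exists, but entropy preservation is a
strictly weaker requirement than privacy + correctness, so that impossibility does not settle it. -/

/-! ## §7 Regimes tried for a counterexample to the ALGORITHMIC content (REMARK; none bites)

* LPN / syndrome entropy (degree-2 samplable: `(u, v) ↦ G(u ⊙ v)` = syndrome of Ber(1/4)ᵐ noise, and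
  noise rates (1 − 2^{-j})/2 from j products): the entropy deficiency `rank − H` is
  `≈ (1/2 ln 2) Σ_{c ∈ rowspace ∖ 0} 4^{-j·wt(c)}`; it is ≥ 1/poly only when the dual has words of weight
  O(log m / j), which information-set decoding finds in polynomial time — no hardness at PEA precision
  (agrees with rattack's smallmodel.py).
* 1-bit coset channel `Y = c + β·b + e` (β a uniform bit, c ∈ C uniform, e Bernoulli): `H(Y) − H(c + e)
  = I(β; Y) ∈ [0,1]` measures `dist(b, C)` at noise scale 4^j, giving a GapNCP-type problem with gap
  factor ≈ dim C / ε² between the thresholds — too coarse (nearly trivial approximation factor), and the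
  quantity is again a weighted count of light dual words.
* IK/AIK branching-program encodings without the second randomiser (`R₁ L(x)`, degree 2): the output
  reveals the row space flag of `L(x)`, its entropy is not a function of `f(x)`; with `R₂` the degree is 3
  and the §6 elimination costs 8^T with T = poly.
* Planted MQ counting: `H = n − E_x log₂ #{x' : q x' = q x}` needs fibre counts through RANDOM known
  points of a WORST-CASE quadratic system within factor √2 on average; for random dense q the second
  moment pins them (no hardness), for structured q no reduction from a standard assumption was found.
* Known counterexample families of the area (`ledger negatives --problem PneNP`: 5 items, none about
  entropy/SZK; barrier catalogue `Literature/Barriers/PneNP/*`: relativization/natural-proofs/algebrization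
  concern the IMPLICATION X ⇒ PneNP, not this membership claim; `LatticeGapCoNP` forbids NP-hardness
  routes, consistent with §3).
Bottom line for cycle 1: the crux is unrefutable in principle short of P ≠ NP (§3); its algorithmic
heuristics ARE refutable and two of them now are (§4 census, §5 Rényi); §6 is the structural fact both
sides should build on. -/

/-! ## §8 The linearised-fibre rank estimator (REMARK; evidence `py/estimators.py`)

The most natural first algorithm for the crux: `H = n − E_x log₂|F(x)|` with
`F(x) = {d : q(x+d) = q(x)} = {d : L_x d + Q̃(d) = 0}` (`L_x` = linear part in `d`, an affine function
of `x`; `Q̃` = the pure quadratic part of `q`), so estimate `log₂|F(x)| ≈ n − rank L_x` and output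
`E1 := E_x rank L_x` (poly-time by sampling `x`).  Numerically (exact enumeration): E1 is EXACT on
`renyiFamily7` (4 = 4) and on `witP1` (7/2), within 0.24 on 40 random dense maps (n ≤ 7) and within
0.34 on 40 random sparse maps (n ≤ 8) — but it is not an additive-O(1) estimator:
* one block `x₀x₁`: H = h(1/4) = 0.8113, E1 = 3/4 (error −0.0613); k disjoint blocks: error −0.0613·k
  (k = 9 exceeds 1/2, k = 17 exceeds 1) — E1, like H (`entropy_prod`) and H₂, is ADDITIVE under direct
  products, and an additive-under-products estimator that is not exact on every map fails PEA₂ by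
  amplification (the same mechanism as §4–§5);
* all pairwise products `(x_i x_j)_{i<j}` on n variables: H → n while E1 → n − 1 (the linearisation
  keeps the phantom direction `d = 1_S`, killed by `Q̃`): error −0.46, −0.64, −0.77 at n = 4, 5, 6,
  tending to −1; `witP4`: −0.34.
So a prover's algorithm must treat the quadratic correction `Q̃(d)` on `ker L_x` non-perturbatively
(it is again an instance of the original problem on a smaller space, with `x`-dependent linear part),
and must NOT be additive under direct products unless exact. -/

/-! ## §7 (cycle 2 additions, REMARK)

* PRECISION OBSTRUCTION for code-theoretic hardness transfers (why MinDistance / LPN / #BIS hardness does not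
  reach Shannon entropy at PEA precision).  Syndrome maps `S = M(u⊙v)` (degree 2; `e = u⊙v` is Ber(1/4)^m,
  bias `β = 1/2`; sums of `j` ANDs give bias `β = 2^{-j}`) have Walsh spectrum `{β^{wt c} : c ∈ D}`,
  `D = rowspace M`, so `r − H(S) = KL(P_S ‖ U)/ln 2` satisfies, rigorously,
  `β^{2k}/(2 ln 2) ≤ r − H(S)` if `D` has a word of weight `≤ k` (project on that character) and
  `r − H(S) ≤ (W_D(β²) − 1)/ln 2 ≤ (1/ln 2) Σ_{w > γk} (mβ²)^w` if `d(D) > γk` (χ² bound, `A_w ≤ m^w`).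
  With `β = 1/m` the two sides separate iff `γ > 2 − 1/k`, at additive precision `≈ m^{−2k}` — polynomial only
  for `k = O(1)`, where Gap-MinDistance is trivially in P.  Constant `β` fails because NO instances may carry
  `m^{Θ(w)}` words at weight `w` slightly above `γk` (extended Hamming / RM codes: `A_4 ≈ L³/24`).  So the
  W[1]/ETH-hardness of Gap-Even-Set at `k = Θ(log m)` does not transfer; this sharpens bullet 1 of §7.
* SHANNON vs the #BIS-hard census (cf. cards syndrome-equivocation / polarize-to-one-bit-leakage, wall B1):
  `p_0 = Pr[Me = 0] = E_v 2^{−rank M_v} = W_{D}(1/2)/2^{rank M}` and `CP(S) = W_D(1/4)/2^{rank M}` are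
  weight-enumerator values (Goldberg–Jerrum: no FPRAS for weight enumerators of binary linear codes at such
  points unless #BIS has one — cited from the cards, NOT re-read this cycle: searchd was down), whereas the crux
  gives `H(S) = m·h(1/4) − H(X|Y)_{BSC(1/4), ker M}` — a QUENCHED average `E_e log₂ W_{K+e}(1/3) + (m/4)log₂3`
  of coset enumerators over the planted (Nishimori) coset, not the annealed `log W_K`.  No reduction from the
  annealed to the quenched quantity at `O(1)` additive precision is known to this file; this is the exact
  place where "crux ⇒ FPRAS for #BIS" would have to be proved to make the crux implausible.
* GRAPHIC SYNDROME MAPS = RANDOM-BOND ISING AT THE NISHIMORI POINT (a sub-family with an exact dictionary,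
  offered to provers as the first non-linear-algebra rung and to ideators as a stress test).  For a graph `G`
  (`N` vertices, `m` edges, connected) put `y_e = σ_i + σ_j + u_e v_e` (`e = ij`; quadratic, `n = N + 2m`).
  Choosing a spanning tree, `y ↦ (y_T, cycle syndromes s = C z)` is an affine bijection with `y_T` uniform and
  independent of `s`, so EXACTLY `H(y) = (N − 1) + H(Cz)` with `z ~ Ber(1/4)^m` and `C` the cycle matrix; and
  `H(Cz) = m·h(1/4) − H(z | Cz)`, `H(z | Cz) = E_z log₂ Z_G(z) + const(m)` where `Z_G(z) = Σ_σ Π_e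
  exp(β J_e σ_iσ_j)`, `J_e = (−1)^{z_e}`, `tanh β = 1/2` — the QUENCHED free energy of the ±J Ising model on `G`
  with `P(J_e = −1) = 1/4`, i.e. on the Nishimori line.  (i) PLANAR `G`: `Z_G(z)` is a Pfaffian (Kasteleyn–Fisher)
  for every `z`, so `E_z log Z_G` is estimable to `±1/poly` by sampling `z` — this sub-family of `PEA₂` IS in BPP
  (a provable positive rung beyond `d ≤ 1`, `m = O(log n)`, and shrunk subspaces).  (ii) General `G`: computing
  `Z_G(z)` for given signs is #P-hard and without FPRAS in the worst case over signs, but the crux needs only the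
  Nishimori AVERAGE of `log Z`, for which neither an algorithm nor a hardness result is known to this file; the
  critical degree at `p = 1/4` is `(d − 1)(1 − 2p)² = 1 ⇔ d = 5`, so random 5-regular `G` sit exactly at the
  Nishimori/Kesten–Stigum transition — the natural hard-looking instances of this shape (finite-size corrections of
  a critical free energy to `O(1)`).  (iii) The same dictionary for the general syndrome map `M(u⊙v)` reads:
  `PEA₂ ⊇` "quenched conditional entropy `H(X|Y)` of an ARBITRARY binary linear code on `BSC(1/4)` to additive
  `O(1)`"; note this is EASY exactly where decoding is hard-but-possible (`H(X|Y) ≈ 0` below capacity) — hardness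
  of decoding does not transfer to entropy; only codes at capacity / critical graphs carry `O(1)`-scale uncertainty.
* DENSE Z₂-SYNCHRONISATION (family (Z) of TRIAGE-r1-3, recorded at the triager's request as the regime no
  card's convergent expansion covers): `y_e = σ_i + σ_j + Σ_{t ≤ j} u_{e,t} v_{e,t}` over all pairs of
  `N = 4^{j+1}` vertices (noise bias `2^{−j} = λ/√N`, `λ = 2`), a degree-2 map with
  `H(y) = E·h(p_j) + (N − 1) − H(σ | y)` and `H(σ|y) = N(1 − i_RS(λ)) + o(N)` [Deshpande–Abbe–Montanari 2016,
  arXiv:1507.08685]: no light words, no splitting, no shrinkage (κ₁ = Θ(N)), yet deciding integer thresholds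
  needs the `o(N)` term to `O(1)`.  It is ONE explicit sequence (so it proves no hardness), but every proposed
  evaluator (kl-polymer, gibbs modeling, polar-star genericity half, syndrome K1) must return its entropy to
  `±1/4`; it is the recommended unit test after `witC/witD` (§4) and `witE/witF` (§9).
-/

/-! ## §9 Directional derivative profiles — collision AND rank, all `2ⁿ` directions — together with the census still do not determine the entropy (cycle 2)

LANDING as `Theorems/PeaTwoMemBPP/Negative/DirectionalProfilesDoNotDetermineEntropy.lean` (p72024, review-
queued: new defs), where the general facts are proved: both profiles are MULTIPLICATIVE under direct products
(`dirCollision_prod`, `dirKernel_prod`, like `census_prod`), hence (`profile_equivalent_gap_unbounded`) for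
every `T` there are quadratic maps with identical census, identical collision profile and identical kernel
profile whose entropies differ by `> T`.  Here: the definitions and the two witness pairs, checked by
evaluation, so that ideators can cite them from this file.

Reading.  For quadratic `q`, `D_h q(x) = q(x+h) − q(x) = B_q(x,h) + Δ(h)` is affine in `x` with linear part the
polarization `B_q(·,h)` of rank `ρ(h)`; so `dirKernel q h = 2^{n−ρ(h)}` IS the derivative-rank profile of
DGRV's algorithm (Lemma 5.1 `ρ ≤ 2H`, Lemma 5.2 `E_h 2^{−ρ(h)} = 2^{−H₂}` in odd characteristic) and of every
kernel-attack statistic (`|K(x)|`, `π(0)`, lemma (L) of TRIAGE-r1-3 are functions of it), and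
`dirCollision q h = 2^{n−ρ(h)}·[Δ(h) ∈ Im B_q(·,h)]` is the directional collision probability (its mean is the
Rényi-2 entropy, `sum_dirCollision` in the Negative file).  CONSEQUENCE: an entropy estimator for quadratic
maps must use POSITIONAL two-point data — which `x` collide along which `h` (the joint law of `(x, K(x))`,
shrunk subspaces `(U,E)`, adjoint-algebra idempotents) — not any combination of per-character biases and
per-direction ranks/collision probabilities; and any invariant that is multiplicative under direct products
(as all three are) decides `PEA₂` only if it determines `H` EXACTLY. -/

/-- `W_P(h) = #{x ∈ F₂ⁿ : P(x + h) = P(x)}`, the directional collision count. [DvirGutfreundRothblumVadhan2010, Lemma 5.2] -/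
def dirCollision (P : PolyMapF2 n) (h : Fin n → ZMod 2) : ℕ :=
  ∑ x : Fin n → ZMod 2, if P.eval (x + h) = P.eval x then 1 else 0

/-- Coordinatewise sum of two output lists. [folklore] -/
def addL (l₁ l₂ : List (ZMod 2)) : List (ZMod 2) := List.zipWith (· + ·) l₁ l₂

/-- `K_P(h) = #{x : P(x+h) + P(x) = P(h) + P(0)}` (`= 2^{n − rank B_P(·,h)}` for quadratic `P`), the
directional kernel = derivative-rank profile. [DvirGutfreundRothblumVadhan2010, Lemma 5.1–5.2] -/
def dirKernel (P : PolyMapF2 n) (h : Fin n → ZMod 2) : ℕ :=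
  ∑ x : Fin n → ZMod 2, if addL (P.eval (x + h)) (P.eval x) = addL (P.eval h) (P.eval 0) then 1 else 0

/-! ### 9.1 Three variables: `(z, zx, zy)` versus `(z, xy)` -/

/-- `Z₁ = (z, zx, zy)` (`x,y,z = x₀,x₁,x₂`): reveals `(x,y)` iff `z = 1`; `H = 2`. -/
def witZ₁ : PolyMapF2 3 := [[[2]], [[0, 2]], [[1, 2]]]
/-- `Z₂ = (z, xy)`: `H = 1 + h(1/4)`. -/
def witZ₂ : PolyMapF2 3 := [[[2]], [[0, 1]]]
/-- Same collision profile `(8; 4,4,4; 0,0,0,0)` … [folklore] -/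
theorem dirCollision_witZ₁_eq_witZ₂ : dirCollision witZ₁ = dirCollision witZ₂ := by native_decide
/-- … different kernel profiles (the collision profile does not see the ranks of non-colliding directions) … -/
theorem dirKernel_witZ₁_ne_witZ₂ : dirKernel witZ₁ ≠ dirKernel witZ₂ := by native_decide
/-- … and different entropies: `Π(Z₁) = 2⁸` (`H = 2`), `Π(Z₂) = 3⁶` (`H = 3 − (3/4)log₂3 = 1.811`). [folklore] -/
theorem fiberProd_witZ : fiberProd witZ₁ = 2 ^ 8 ∧ fiberProd witZ₂ = 3 ^ 6 := by
  constructor <;> native_decide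

/-! ### 9.2 The triple-invariant pair on `n = m = 4` (search `c/trisearch.c`) -/

/-- `E = (1 + x₀ + x₁ + x₀x₂ + x₁x₃, x₀x₃ + x₂x₃, x₀ + x₁ + x₀x₂ + x₁x₃ + x₂x₃, 1 + x₃ + x₂x₃)`: `Π = 2^24`, `H = 5/2`. -/
def witE : PolyMapF2 4 :=
  [[[], [0], [1], [0, 2], [1, 3]], [[0, 3], [2, 3]], [[0], [1], [0, 2], [1, 3], [2, 3]], [[], [3], [2, 3]]]
/-- `F = (x₃ + x₂x₃, 1 + x₀x₃, 1 + x₂ + x₃ + x₀x₂ + x₁x₃ + x₂x₃, x₂x₃)`: `Π = 2^8·3^6`, `H = 7/2 − (3/8)log₂3`. -/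
def witF : PolyMapF2 4 :=
  [[[3], [2, 3]], [[], [0, 3]], [[], [2], [3], [0, 2], [1, 3], [2, 3]], [[2, 3]]]

/-- Both quadratic. [folklore] -/
theorem witEF_degLE : witE.DegLE 2 ∧ witF.DegLE 2 := by decide
/-- Same census. [folklore] -/
theorem census_witE_eq_witF : census witE = census witF := by native_decide
/-- Same collision profile (16 directions, pointwise). [folklore] -/
theorem dirCollision_witE_eq_witF : dirCollision witE = dirCollision witF := by native_decide
/-- Same kernel (derivative-rank) profile. [folklore] -/
theorem dirKernel_witE_eq_witF : dirKernel witE = dirKernel witF := by native_decide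
/-- `Π(E) = 2^24`, `Π(F) = 2^8·3^6`. [folklore] -/
theorem fiberProd_witEF : fiberProd witE = 2 ^ 24 ∧ fiberProd witF = 2 ^ 8 * 3 ^ 6 := by
  constructor <;> native_decide

/-- **Gap `> 2/5`** (true value `1 − (3/8)log₂3 = 0.4056…`) between two quadratic maps with identical census,
collision profile and kernel profile. -/
theorem entropy_gap_EF : (2 : ℝ) / 5 < witF.entropy - witE.entropy := by
  have h : 2 ^ 32 * fiberProd witF ^ 5 < fiberProd witE ^ 5 := by
    rw [fiberProd_witEF.1, fiberProd_witEF.2]; norm_num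
  have := entropy_gap_of_fiberProd_pow (by norm_num) h
  norm_num at this ⊢
  linarith

/-- **Census + collision profile + kernel profile do not determine the entropy of quadratic maps**
(unbounded version: `profile_equivalent_gap_unbounded` in the Negative file, by multiplicativity). -/
theorem profiles_do_not_determine_entropy :
    ∃ n : ℕ, ∃ C D : PolyMapF2 n, C.DegLE 2 ∧ D.DegLE 2 ∧ census C = census D ∧
      dirCollision C = dirCollision D ∧ dirKernel C = dirKernel D ∧ (2 : ℝ) / 5 < D.entropy - C.entropy :=
  ⟨4, witE, witF, witEF_degLE.1, witEF_degLE.2, census_witE_eq_witF, dirCollision_witE_eq_witF,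
    dirKernel_witE_eq_witF, entropy_gap_EF⟩

/-! ## §10 No entropy-exact LOCAL quadratic gadget for a cubic monomial (cycle 2) — why §6 needs signs

Question (REMARK 6.2 (iii), "the sharpest open question this file isolates"): is there a SINGLE quadratic
gadget — replace one occurrence of `μ = x_a x_b x_c` in coordinate `i` of a cubic map `p` by a quadratic
`A(ξ, w)` (`ξ = (x_a,x_b,x_c)`, `w ∈ F₂ˢ` fresh variables) and append `t'` fresh quadratic outputs `B(ξ, w)` —
with `H(p[μ → A] ⊕ B) = H(p) + c` for EVERY cubic `p` (one constant `c`)?  Such a gadget, iterated over the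
occurrences, would be a Karp reduction `PEA₃ ≤ PEA₂`, making the crux EQUIVALENT to the kill switch
`PeaThreeMemBPP` (= `SZK_L ⊆ BPP`: GI, QR, DLOG, GapCVP_√n easy), i.e. morally FALSE.  Findings:

THEOREM 10.1 (reduction to a finite algebraic problem; paper proof, 15 lines, every step an entropy identity).
If `(A,B)` is exact on the seven test maps `(μ + y₀)`, `(μ + y₀, ξ)`, `(μ, ξ)`, `(μ)`, `(μ + x_l·y₀)`
(`l ∈ {a,b,c}`, `y₀` a further variable) with a common offset `c`, then
  (i)  `c = H(B)` and `B ⊥ ξ` (the law of `B(ξ, U_s)` does not depend on `ξ`)  [offsets `H(B)` vs `H(B|ξ)`];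
  (ii) `A = F(ξ, B)` pointwise  [offset of `(μ, ξ)` is `H(B|ξ) + H(A | ξ, B)`];
  (iii) `H(A|B) = h(1/8)` and the ℚ-linear independence of `1, log₂3, log₂5, log₂7` force every
        `F(·, b)` (`b ∈ supp B`) to have weight 1 or 7 on `F₂³` [entropies of Boolean functions on 3 bits lie
        in `{0, h(1/8), h(1/4), h(3/8), 1}` and only `h(1/8)` carries `log₂7`];
  (iv) the maps `(μ + x_l y₀)` force the point to be `(1,1,1)` [`h(3/8)` carries `log₂5`], so
        **`A = x_a x_b x_c + c∘B` for a Boolean function `c` on `F₂^{t'}`**;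
hence an exact gadget exists iff there is a QUADRATIC `B : F₂³ × F₂ˢ → F₂^{t'}` with `B ⊥ ξ` and a Boolean
`c` with `deg(x_a x_b x_c + c∘B) ≤ 2` — "the algebra generated by the coordinates of a `ξ`-independent
quadratic map contains the cubic monomial modulo quadratics".  (Changing `B` by an invertible affine map of
its outputs is free, so `c` may be normalised modulo `RM(1)` and `AGL(t')`: `t' = 1` impossible (c affine),
`t' = 2` ⟺ `B₁B₂ ≡ μ`, `t' = 3` ⟺ `B₁B₂B₃ ≡ μ (mod RM(2))`.)

THEOREM 10.2 (no exact gadget in the searched range; exhaustive, programs `c/gadget.c`, `c/pairsolve.c`,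
`c/pairsolve7.c`, `c/t3solve.c`, output log attached as evidence `gadget_search.txt`):
  * `s = 1`, any `t'`: none (paper: over one fresh bit a `ξ`-independent law is a fixed two-point law, so `B`
    takes two values and `c∘B` is affine in the selector bit);
  * `t' = 2`, `s ≤ 4` (`N = 3 + s ≤ 7` variables, all `2^{29}` quadratics at `s = 4`): none — for each of the
    64 / 3136 / 211008 / 30163008 quadratics `B₁` with `ξ`-independent marginal, the affine space of quadratic
    `B₂` with `B₁B₂ ≡ μ` is computed (non-empty for 56 / 1512 / 9800 / 47880 of them) and NO solution has a
    `ξ`-independent joint law;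
  * `t' = 3`, `s ≤ 3`: none — stronger: among the 35310 (`s=2`) / 7219250 (`s=3`, 219 orbit representatives
    of `B₁` under `S₃ × AGL(3,2)` times all `B₂`) `ξ`-independent PAIRS `(B₁,B₂)`, not one admits ANY quadratic
    `B₃` with `B₁B₂B₃ ≡ μ (mod RM(2))` (an empty affine space every time).
THEOREM 10.3 (one-time-pad gadgets, all sizes; paper).  For `B = m(ξ) + w` (`t' = s`, each output padded by
its own fresh bit — the AIK/§6 shape) no `c` works: the top `w`-degree of `c(m(ξ)+w)` is `deg c`, so
`deg c ≤ 2`, `c = Σ c_ij b_ib_j + affine`; vanishing of the cubic terms `w_j·Q_i(ξ)` (`Q_i` = quadratic part of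
`m_i`) means `Σ_i c_ij Q_i = 0` for all `j`, i.e. `q_eᵀ C = 0` for the three coefficient rows `q_e`
(`e ∈ {ab, ac, bc}`), and then the `μ`-coefficient of `Σ_{i<j} c_ij m_i m_j`, which equals
`Σ_{e<e'} q_eᵀ C q_{e'}` (cross terms `Q_i·L_j` contribute `Σ_j coef_μ((Σ_i c_ij Q_i)L_j) = 0`), vanishes —
but it must be `1`.
NEAR-MISSES = §6 (REMARK 10.4, `nearMiss_identity` below).  The degree condition ALONE is satisfiable, and its
sparsest solutions with `ξ`-independent MARGINALS are exactly the pairs `B₁ = w + x_ax_b`, `B₂ = B₁ + x_c`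
(`μ + B₁B₂ = B₁ + w·x_c`, 1008 such pairs at `s = 2`): each output alone is a uniform bit, but
`B₁ + B₂ = x_c` leaks a linear form of `ξ` — this IS the gadget `q_u` of §6 with its revealed tag, whose
entropy is the AVERAGE `1 + ½H(p) + ½H(p + u e_i)` (identity (1)), not `H(p) + c`.  In every solution of the
degree equation found, the outputs jointly leak a linear form of `ξ`; the signs in (3) are the price of
removing that leak by inclusion–exclusion over the seven forms.
THEOREM 10.4 (cycle 2, later the same day: CONJECTURE G IS TRUE — machine-checked, LANDED/LANDING as
Theorems/PeaTwoMemBPP/Negative/QuadraticCharSums.lean (p73722, commit 9847aa4fb381) +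
NoXiIndependentQuadraticEncoding.lean (p74755) + SparseQuadraticGadget.lean (bridge from `PolyMapF2.DegLE 2`, corollary
`no_sparse_quadratic_gadget`; to follow),
theorem `no_xi_independent_quadratic_encoding`, axioms propext/choice/Quot.sound, no `native_decide`).
**For every `s, t'`: there is no quadratic `B : F₂³ × F₂ˢ → F₂^{t'}` with `B ⊥ ξ`, Boolean `c` and quadratic
`Q` with `x_ax_bx_c + Q = c∘B`.**  Hence (with THEOREM 10.1) NO entropy-exact local quadratic gadget for a cubic
monomial exists, of any size; the signs of §6 (3) are necessary; a Karp reduction `PEA₃ ≤ PEA₂`, if any, is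
non-local.  PROOF ("3 ∤ 2ʲ", ten lines).  On a fibre `V_b = {B = b}`, `Q = μ + c(b)`; equidistribution of `V_b`
over the eight `ξ`-slices gives `8·Σ_{V_b}(−1)^Q = (−1)^{c(b)}|V_b|·Σ_ξ(−1)^{μ(ξ)} = 6(−1)^{c(b)}|V_b|` and
`8·Σ_{V_b}(−1)^{Q+ξ_a} = 2(−1)^{c(b)}|V_b|`.  Summing against `(−1)^{u·b}`: `8 S(f_u) = 6 K_u`,
`8 S(f_u + ξ_a) = 2 K_u` for `f_u := Q + u·B` (degree ≤ 2), `S` = character sum over `F₂^{3+s}`,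
`K_u := Σ_b (−1)^{u·b+c(b)}|V_b| ∈ ℤ`; so `S(f_u) = 3 S(f_u + ξ_a)`.  For `f` of degree ≤ 2 on an elementary abelian
2-group, `S(f)² = Σ_a S(D_a f) ∈ {0, |G|·|R|}` with `R` = radical (directions of constant derivative: off `R` the
derivative is a non-constant affine function, balanced; on `R`, `a ↦ f(a)+f(0)` is additive, so the signed count is
`0` or `|R|`), and `R` is the same for `f_u` and `f_u + ξ_a`; `S(f_u)² = 9 S(f_u+ξ_a)²` forces both to vanish, so
`K_u = 0` for all `u`, and Fourier inversion on `F₂^{t'}` gives `|V_b| = 0` for every `b` — absurd (`0 ∈ V_{B(0)}`).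
The obstruction is arithmetic: the bias `3/4` of a cubic monomial survives conditioning on any `ξ`-independent
σ-algebra, while every quadratic character sum is `0` or `±2ʲ`.  The same proof excludes `ξ`-independent quadratic
encodings of ANY Boolean `g(ξ)` whose character sum is not `0` or `± a power of 2` (all monomials of degree ≥ 3:
`Σ(−1)^g = 2^d − 2`), and it needs `B` quadratic only through "every `u·B + Q` has character sum in `{0, ±2ʲ}`"
(so it also covers `B` with bent/plateaued-with-power-of-2 combinations).  THEOREM 10.2's searches are thereby
explained, and the near-misses below are exactly the maps violating independence. -/

/-- **The near-miss identity** (`s = 1`, `t' = 2`; variables `x₀,x₁,x₂ = ξ`, `x₃ = w`): with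
`B₁ = w + x₀x₁` and `B₂ = B₁ + x₂`, `x₀x₁x₂ + B₁B₂ = B₁ + w·x₂` is QUADRATIC — the degree equation of
THEOREM 10.1 is solvable — while `B₁ + B₂ = x₂` shows the pair is not `ξ`-independent. [folklore] -/
theorem nearMiss_identity : ∀ x : Fin 4 → ZMod 2,
    x 0 * x 1 * x 2 + (x 3 + x 0 * x 1) * (x 3 + x 0 * x 1 + x 2) = (x 3 + x 0 * x 1) + x 3 * x 2 := by
  decide

/-- … each of `B₁`, `B₂` alone IS `ξ`-independent (a fresh uniform bit: exactly half of the `w` give `1`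
for every `ξ`), which is why the marginal tests of THEOREM 10.2 pass and only the joint law fails. [folklore] -/
theorem nearMiss_marginals : ∀ ξ : Fin 3 → ZMod 2,
    (Finset.univ.filter fun w : ZMod 2 => w + ξ 0 * ξ 1 = 1).card = 1 ∧
    (Finset.univ.filter fun w : ZMod 2 => w + ξ 0 * ξ 1 + ξ 2 = 1).card = 1 := by
  decide


end Summit.PneNP.PneNP.Cruxes.PeaTwoMemBPP.Disproof
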